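import Summits.ResolutionOfSingularities.ResolutionOfSingularities.Theorems.WeightedInvariantLocalWeightedDropNCDirectrixCutBadAxis

/-!
# `WeightedInvariant.LocalWeightedDrop` (stmt-ResolutionOfSingularities-8899), registered stub W′|₄ `stub_wildWideApexFourStartsWon`:
# THE BAD₃ GLUE IN THE TREE — the BAD escape of the unary position split from the PLANE stub `stub_badPlaneThree` alone

[OURS · route `ResolutionOfSingularities/WeightedInvariant` · ENGINE crux `LocalWeightedDrop` (stmt-ResolutionOfSingularities-8899), skeleton v36
`ae852bbacee88029`, registered stub W′|₄ · res-L1-w43-strat-1's BAD₃ split (`g11/bad3_split_v2.lean` 951d89617e9061ae: Part A `|S| ≥ 3` = the tree's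
`NCResBad3.dWinsTo_exit_of_badDir_three`, `…NCDirectrixCutBadAxis`; Part B = the one stub `stub_badPlaneThree`; Part C glue kernel-checked there).
Candidates of the programme's own count game; nothing here is a statement of, or about, any manuscript; AI-written, weaker than expert review;
counted 0; proves no summit and closes no registered stub.]

## What this file does (the strategist's Part C VERBATIM, the plane stub as an explicit hypothesis; no definition, no new axiom)

* `badTarget_of_exitThree` (PROVED) and `unaryBadEscapeThree_of` — **the BAD escape `stub_unaryBadEscapeThree` (unary position split v2, VERBATIM;
  hypothesis `hB` of `UnaryPositionCensus.coreUnaryWildThree_of_leaves` / `freeTameThree_of_leaves`, `…NCDirectrixCutUnaryPositionGlue`) ⟸ the PLANE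
  stub `stub_badPlaneThree` VERBATIM** (`|S| = 2`: order reduction of the weighted family `𝒫_L` on the regular surface germ `L = V(x_{j₁}, x_{j₂})`
  with SNC boundary — dimension two, characteristic-free, Cossart–Jannsen–Saito / Benito–Villamayor class modulo the game dictionary; size L–XL).
So in the kernel census of W′|₄ the leaf «BAD escape» is refined to «`stub_badPlaneThree`».
-/

set_option linter.dupNamespace false -- mandated namespace of this single-conjunct summit

noncomputable section

namespace Summit.ResolutionOfSingularities.ResolutionOfSingularities.Theorems

namespace TameFourTupleDrop

namespace BadEscapeCensus

open MvPowerSeries Literature.AlgebraicGeometry.Resolution NCResBad GraphCurve TOT2E1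

/-- Part A's target implies the B-target (same head: not unary, or unary and GOOD). -/
theorem badTarget_of_exitThree {k : Type} [Field k] {δ : Decoration k 3} (τ : MvPowerSeries (Fin 4) k × Decoration k 3)
    (h : Admissible τ.1 τ.2 ∧ (τ.2.head < δ.head ∨ (τ.2.head = δ.head ∧ (¬ UnaryVertex τ.2 ∨ τ.2.GoodDir)))) :
    (GermIsNC τ.1 ∨ (Admissible τ.1 τ.2 ∧ (τ.2.head < δ.head ∨ (τ.2.head = δ.head ∧ ¬ UnaryVertex τ.2)))) ∨
      (Admissible τ.1 τ.2 ∧ τ.2.head = δ.head ∧ UnaryVertex τ.2 ∧ τ.2.GoodDir) := by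
  obtain ⟨hadm, hlt | ⟨heq, hnu | hg⟩⟩ := h
  · exact Or.inl (Or.inr ⟨hadm, Or.inl hlt⟩)
  · exact Or.inl (Or.inr ⟨hadm, Or.inr ⟨heq, hnu⟩⟩)
  · by_cases hU : UnaryVertex τ.2
    · exact Or.inr ⟨hadm, heq, hU, hg⟩
    · exact Or.inl (Or.inr ⟨hadm, Or.inr ⟨heq, hU⟩⟩)

/-- **THE BAD₃ GLUE: `stub_unaryBadEscapeThree` (unary position split v2, VERBATIM) from the plane stub alone** — `|S| ≥ 3` by Part A
(`NCResBad3.dWinsTo_exit_of_badDir_three`), `|S| = 2` by `stub_badPlaneThree` followed (`DWinsTo.bind`) by Part A at a `|S| ≥ 3` exit, heads transported. -/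
theorem unaryBadEscapeThree_of
    (hPlane : ∀ (p : ℕ), p.Prime → ∀ (k : Type) [Field k] [CharP k p] [IsAlgClosed k],
      ∀ (b : MvPowerSeries (Fin 4) k) (δ : Decoration k 3) (ℓ : Fin 4 → k) (j₁ j₂ : Fin 4),
        Admissible b δ → 2 ≤ δ.o → UnaryVertex δ → δ.O = ∅ → δ.IsDirForm ℓ → (∀ j, ℓ j ≠ 0 → j ∈ δ.E) →
        j₁ ≠ j₂ → ℓ j₁ ≠ 0 → ℓ j₂ ≠ 0 → (∀ l, l ≠ j₁ → l ≠ j₂ → ℓ l = 0) →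
        DWinsTo (St := MvPowerSeries (Fin 4) k × Decoration k 3) Prod.fst
          (fun τ => ((GermIsNC τ.1 ∨ (Admissible τ.1 τ.2 ∧ (τ.2.head < δ.head ∨ (τ.2.head = δ.head ∧ ¬ UnaryVertex τ.2)))) ∨
            (Admissible τ.1 τ.2 ∧ τ.2.head = δ.head ∧ UnaryVertex τ.2 ∧ τ.2.GoodDir)) ∨
            (Admissible τ.1 τ.2 ∧ τ.2.head = δ.head ∧ UnaryVertex τ.2 ∧ τ.2.O = ∅ ∧
              ∃ ℓ' : Fin 4 → k, τ.2.IsDirForm ℓ' ∧ (∀ j, ℓ' j ≠ 0 → j ∈ τ.2.E) ∧ ∃ j, ∀ l, l ≠ j → ℓ' l ≠ 0)) (b, δ)) :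
    ∀ (p : ℕ), p.Prime → ∀ (k : Type) [Field k] [CharP k p] [IsAlgClosed k],
      ∀ (b : MvPowerSeries (Fin 4) k) (δ : Decoration k 3), Admissible b δ → 2 ≤ δ.o → UnaryVertex δ → δ.BadDir →
        DWinsTo (St := MvPowerSeries (Fin 4) k × Decoration k 3) Prod.fst
          (fun τ => (GermIsNC τ.1 ∨ (Admissible τ.1 τ.2 ∧ (τ.2.head < δ.head ∨ (τ.2.head = δ.head ∧ ¬ UnaryVertex τ.2)))) ∨
            (Admissible τ.1 τ.2 ∧ τ.2.head = δ.head ∧ UnaryVertex τ.2 ∧ τ.2.GoodDir)) (b, δ) := by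
  intro p hp k _ _ _ b δ hadm ho hU hbad
  classical
  obtain ⟨hO, ℓ, hℓ, hsupp, j₁, j₂, hj, hj₁, hj₂⟩ := hbad
  -- `|S| ≥ 3` states with the head of `δ` are won towards the B-target of `δ` (Part A, heads transported)
  have hThree : ∀ (b' : MvPowerSeries (Fin 4) k) (δ' : Decoration k 3) (ℓ' : Fin 4 → k), Admissible b' δ' → δ'.head = δ.head → δ'.O = ∅ →
      δ'.IsDirForm ℓ' → (∀ j, ℓ' j ≠ 0 → j ∈ δ'.E) → (∃ j, ∀ l, l ≠ j → ℓ' l ≠ 0) →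
      DWinsTo (St := MvPowerSeries (Fin 4) k × Decoration k 3) Prod.fst
        (fun τ => (GermIsNC τ.1 ∨ (Admissible τ.1 τ.2 ∧ (τ.2.head < δ.head ∨ (τ.2.head = δ.head ∧ ¬ UnaryVertex τ.2)))) ∨
          (Admissible τ.1 τ.2 ∧ τ.2.head = δ.head ∧ UnaryVertex τ.2 ∧ τ.2.GoodDir)) (b', δ') := by
    intro b' δ' ℓ' hadm' hhead hO' hℓ' hsupp' h3
    have ho' : δ'.o = δ.o := by
      have h := hhead
      rw [Decoration.head, Decoration.head, toLex_inj, Prod.mk.injEq] at h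
      exact h.1
    refine (NCResBad3.dWinsTo_exit_of_badDir_three hadm' (by rw [ho']; exact ho) hO' hℓ' hsupp' h3).mono fun τ hτ => ?_
    have hτ' : Admissible τ.1 τ.2 ∧ (τ.2.head < δ.head ∨ (τ.2.head = δ.head ∧ (¬ UnaryVertex τ.2 ∨ τ.2.GoodDir))) := by
      obtain ⟨hadmτ, hlt | ⟨heq, hrest⟩⟩ := hτ
      · exact ⟨hadmτ, Or.inl (lt_of_lt_of_eq hlt hhead)⟩
      · exact ⟨hadmτ, Or.inr ⟨heq.trans hhead, hrest⟩⟩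
    exact badTarget_of_exitThree τ hτ'
  by_cases h3 : ∃ j, ∀ l, l ≠ j → ℓ l ≠ 0
  · exact hThree b δ ℓ hadm rfl hO hℓ hsupp h3
  · -- `|S| = 2`: the plane stub, then Part A at a `|S| ≥ 3` exit
    have hrest : ∀ l, l ≠ j₁ → l ≠ j₂ → ℓ l = 0 := NCResBad3.eq_zero_of_not_three hj hj₁ hj₂ h3
    refine (hPlane p hp k b δ ℓ j₁ j₂ hadm ho hU hO hℓ hsupp hj hj₁ hj₂ hrest).bind fun τ hτ => ?_
    obtain ⟨b'', δ''⟩ := τ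
    rcases hτ with hT | ⟨hadm'', hhead'', -, hO'', ℓ'', hℓ'', hsupp'', h3''⟩
    · exact DWinsTo.of_target hT
    · exact hThree b'' δ'' ℓ'' hadm'' hhead'' hO'' hℓ'' hsupp'' h3''

end BadEscapeCensus

end TameFourTupleDrop

end Summit.ResolutionOfSingularities.ResolutionOfSingularities.Theorems

end
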